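import Literature.MathematicalPhysics.QuantumLattice.DWaveSourceKomaTasakiFieldTTPrime
import Literature.MathematicalPhysics.QuantumLattice.DWaveSourceKomaTasakiPairLRO
import HarnessLib

/-!
# Koma–Tasaki for the summit's pair-field long-range order at every `t'`:
# `Re⟨Δ_d†Δ_d⟩ ≥ c·L⁴` in ground states of `hubbardTorusTT' − μN` ⟹ `dWaveOrderParameterTT' t' U μ ≥ √c`

Topic `Literature/MathematicalPhysics/QuantumLattice` (namespace = path; family `hubbard`). The `t' ≠ 0` TWIN
of `DWaveSourceKomaTasakiPairLRO.lean` (hubbard-cq-p4 g0): T. Koma, H. Tasaki, Commun. Math. Phys. **158**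
(1993) Theorem 7.3 (7.11) and J. Stat. Phys. **76** (1994) Theorem 2.5 (2.30), §3.3 — `m ≥ √2 σ` for a `U(1)`
order parameter — for the `d`-wave pair field of the two-dimensional `t–t'` Hubbard model, with the long-range
order measured in the summit's currency `Re Φ†Δ_d†Δ_dΦ ≥ c·L⁴` (`HasPairFieldLRO`) rather than by
`Re Φ†(Δ_d+Δ_d†)²Φ`.  The explicit-constant KT93 7.3 at every `t'` is `le_dWaveOrderParameterTT'_of_pairLRO`
(`DWaveSourceKomaTasakiFieldTTPrime.lean`, built on the `3 × 3`-block Koma–Tasaki system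
`dWaveKTSystemTT'` of `DWaveKomaTasakiSystemTTPrime.lean`); the charge selection rules
`Φ†Δ_d²Φ = 0 = Φ†(Δ_d†)²Φ` and the dictionary `Φ†(Δ_d+Δ_d†)²Φ = 2·Φ†Δ_d†Δ_dΦ + Φ†[Δ_d,Δ_d†]Φ`
(`dotProduct_order_sq_eq_of_number_eigenvector`) and the locality bound `|Re Φ†[Δ_d,Δ_d†]Φ| ≤ C·L²`
(`exists_abs_re_expect_commutator_pairField_le`) are Hamiltonian-free and reused verbatim.

* **`le_dWaveOrderParameterTT'_of_pairFieldLRO`** — if eventually in `L` the torus `(ℤ/(L+1)ℤ)²` carries a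
  normalised particle-number-eigenvector ground state of `hubbardTorusTT' (L+1) 1 t' U − μN` with
  `c·(L+1)⁴ ≤ Re Φ†Δ_d†Δ_dΦ`, then `√c ≤ dWaveOrderParameterTT' t' U μ` (the `√2`-sharp Koma–Tasaki
  direction LRO ⟹ response, written for the cuprate cell `hubbard-cq`, CQ anchor `(U, n, t') = (8, 7/8, −1/4)`).

Everything PROVED; no definition, no named fact, zero compute. HONEST SCOPE: direction LRO ⟹ response only
(`Literature.Barriers.HubbardSuperconductivity.SourcedOrderWithoutGroundStateLRO`); a CEILING on ground-state
pair LRO read contrapositively, never a floor.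

## References
* T. Koma, H. Tasaki, Commun. Math. Phys. 158 (1993) 191–214, Theorem 7.3 (7.11). [cite: KomaTasaki1993, Theorem 7.3 (7.11)]
* T. Koma, H. Tasaki, J. Stat. Phys. 76 (1994) 745–803, §1, Theorem 2.5 (2.30), §3.3. [cite: KomaTasaki1994, Theorem 2.5 (2.30)]
-/

noncomputable section

open Matrix Complex Finset WithLp Literature.Probability.LatticeModels
open Literature.Barriers.HubbardSuperconductivity
open scoped Matrix.Norms.L2Operator InnerProductSpace ComplexConjugate ComplexOrder

namespace Literature.MathematicalPhysics.QuantumLattice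

open KomaTasaki DWaveKT Filter
open scoped Topology

attribute [local instance 10000] instDecidableEqFermionTorusKT

section PairFieldLROTT

variable {L : ℕ}

/-- A unit Fock vector is a unit vector of `EuclideanSpace` (via the tree's `norm_toLp_sq_eq_re`). [folklore] -/
private theorem norm_toLp_eq_one_of {v : FockIdx L → ℂ} (hv : star v ⬝ᵥ v = 1) :
    ‖(toLp 2 v : EuclideanSpace ℂ (FockIdx L))‖ = 1 := by
  have h2 : ‖(toLp 2 v : EuclideanSpace ℂ (FockIdx L))‖ ^ 2 = 1 := by
    rw [norm_toLp_sq_eq_re, hv, Complex.one_re]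
  have h0 : 0 ≤ ‖(toLp 2 v : EuclideanSpace ℂ (FockIdx L))‖ := norm_nonneg _
  nlinarith

variable (t' U μ : ℝ)

/-- **Koma–Tasaki for the summit's pair-field long-range order, at every next-nearest-neighbour hopping
`t'`.**  If, eventually in `L`, the grand-canonical `t–t'` Hamiltonian `hubbardTorusTT' (L+1) 1 t' U − μN` on
`(ℤ/(L+1)ℤ)²` has a normalised particle-number-eigenvector ground state `Φ` with PAIR-FIELD long-range order
`c·(L+1)⁴ ≤ Re Φ†Δ_d†Δ_dΦ` (`c > 0`; the finite-volume form of the summit's `HasPairFieldLRO` currency), then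
the Koma–Tasaki `d`-wave order parameter of the `t–t'` model satisfies `dWaveOrderParameterTT' t' U μ ≥ √c`
— Koma–Tasaki's `m ≥ √2 σ` in the tree's normalisation (`(Δ_d+Δ_d†)²`-order `= 2·Δ_d†Δ_d`-order up to the
`O(L²)` commutator `[Δ_d,Δ_d†]`, `exists_abs_re_expect_commutator_pairField_le`, and the charge selection
rules `dotProduct_order_sq_eq_of_number_eigenvector` of the `t' = 0` file, which do not involve the
Hamiltonian).  The `t' ≠ 0` twin of `le_dWaveOrderParameter_of_pairFieldLRO`, on top of
`le_dWaveOrderParameterTT'_of_pairLRO`.  Contrapositive (cuprate anchor `t' = −1/4`): a certified ceiling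
`dWaveOrderParameterTT' t' U μ ≤ m` excludes ground-state pair-field LRO at every level `c > m²`.
[cite: KomaTasaki1993, Theorem 7.3 (7.11)] [cite: KomaTasaki1994, §1, Theorem 2.5 (2.30), §3.3] -/
theorem le_dWaveOrderParameterTT'_of_pairFieldLRO (c : ℝ) (hc : 0 < c)
    (hLRO : ∀ᶠ L : ℕ in atTop, ∃ (Φ : FockIdx (L + 1) → ℂ) (ν : ℂ), star Φ ⬝ᵥ Φ = 1 ∧
      (hubbardTorusTT' (L + 1) 1 t' U - (μ : ℂ) • totalNumber).IsGroundStateVector Φ ∧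
        totalNumber *ᵥ Φ = ν • Φ ∧
      c * ((L + 1 : ℕ) : ℝ) ^ 4 ≤
        (star Φ ⬝ᵥ ((pairField dWaveFormFactor (L + 1))ᴴ *ᵥ
          (pairField dWaveFormFactor (L + 1) *ᵥ Φ))).re) :
    Real.sqrt c ≤ dWaveOrderParameterTT' t' U μ := by
  set K : ℝ := pairNormConst dWaveFormFactor with hKdef
  have hK : 0 < K := pairNormConst_dWave_pos
  obtain ⟨C, L₁, hC0, hC⟩ := exists_abs_re_expect_commutator_pairField_le dWaveFormFactor
  -- (i) `c ≤ K²` (pair-field LRO cannot exceed `‖Δ_d‖²/L⁴ ≤ K²`)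
  have hcK : c ≤ K ^ 2 := by
    obtain ⟨L, Φ, ν, hΦ1, -, -, hlro⟩ := hLRO.exists
    have hre : (star Φ ⬝ᵥ ((pairField dWaveFormFactor (L + 1))ᴴ *ᵥ
        (pairField dWaveFormFactor (L + 1) *ᵥ Φ))).re =
        ‖(toLp 2 (pairField dWaveFormFactor (L + 1) *ᵥ Φ) : EuclideanSpace ℂ (FockIdx (L + 1)))‖ ^ 2 := by
      rw [norm_toLp_sq_eq_re, dotProduct_mulVec, ← star_mulVec]
    have hn1 : ‖(toLp 2 Φ : EuclideanSpace ℂ (FockIdx (L + 1)))‖ = 1 := norm_toLp_eq_one_of hΦ1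
    have hbound : ‖(toLp 2 (pairField dWaveFormFactor (L + 1) *ᵥ Φ) :
        EuclideanSpace ℂ (FockIdx (L + 1)))‖ ≤ K * ((L + 1 : ℕ) : ℝ) ^ 2 := by
      rw [← toEuclideanCLM_toLp]
      refine (ContinuousLinearMap.le_opNorm _ _).trans ?_
      rw [hn1, mul_one, Matrix.l2_opNorm_toEuclideanCLM]
      exact norm_pairField_le dWaveFormFactor (L + 1)
    have hpos : (0 : ℝ) < ((L + 1 : ℕ) : ℝ) ^ 4 := by positivity
    have h1 : c * ((L + 1 : ℕ) : ℝ) ^ 4 ≤ (K * ((L + 1 : ℕ) : ℝ) ^ 2) ^ 2 := by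
      rw [hre] at hlro
      exact hlro.trans (pow_le_pow_left₀ (norm_nonneg _) hbound 2)
    have h2 : (K * ((L + 1 : ℕ) : ℝ) ^ 2) ^ 2 = K ^ 2 * ((L + 1 : ℕ) : ℝ) ^ 4 := by ring
    rw [h2] at h1
    exact le_of_mul_le_mul_right h1 hpos
  -- (ii) every `s` with `s² < 2c` is an admissible `(Δ+Δ†)²`-order level, eventually
  have hstep : ∀ s : ℝ, 0 < s → s ^ 2 < 2 * c →
      Real.sqrt 2 * s / 2 ≤ dWaveOrderParameterTT' t' U μ := by
    intro s hs hs2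
    have hsK : s ≤ 2 * K := by nlinarith [hcK, hK]
    apply le_dWaveOrderParameterTT'_of_pairLRO t' U μ s hs hsK
    have hgap : 0 < 2 * c - s ^ 2 := by linarith
    have hev : ∀ᶠ L : ℕ in atTop, C ≤ (2 * c - s ^ 2) * ((L + 1 : ℕ) : ℝ) ^ 2 := by
      rw [eventually_atTop]
      refine ⟨⌈C / (2 * c - s ^ 2)⌉₊, fun L hL => ?_⟩
      have h1 : C / (2 * c - s ^ 2) ≤ L := (Nat.le_ceil _).trans (by exact_mod_cast hL)
      rw [div_le_iff₀ hgap] at h1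
      have h2 : (L : ℝ) ≤ ((L + 1 : ℕ) : ℝ) ^ 2 := by
        have : (L : ℝ) ≤ ((L + 1 : ℕ) : ℝ) := by exact_mod_cast Nat.le_succ L
        have h1' : (1 : ℝ) ≤ ((L + 1 : ℕ) : ℝ) := by exact_mod_cast Nat.succ_le_succ (Nat.zero_le L)
        nlinarith
      nlinarith
    filter_upwards [hLRO, hev, eventually_ge_atTop L₁] with L hL hCL hL1
    obtain ⟨Φ, ν, hΦ1, hgs, hN, hlro⟩ := hL
    refine ⟨Φ, ν, hΦ1, hgs, hN, ?_⟩
    have hsel := dotProduct_order_sq_eq_of_number_eigenvector (L := L + 1) dWaveFormFactor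
      pairNormConst_dWave_pos hN
    have hcomm := hC (L + 1) (Nat.le_succ_of_le hL1) Φ hΦ1
    unfold expect at hcomm
    have hcomm' := (abs_le.mp hcomm).1
    rw [hsel, Complex.add_re]
    have hre2 : ((2 : ℂ) * (star Φ ⬝ᵥ ((pairField dWaveFormFactor (L + 1))ᴴ *ᵥ
        (pairField dWaveFormFactor (L + 1) *ᵥ Φ)))).re =
        2 * (star Φ ⬝ᵥ ((pairField dWaveFormFactor (L + 1))ᴴ *ᵥ
          (pairField dWaveFormFactor (L + 1) *ᵥ Φ))).re := by
      simp [Complex.mul_re]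
    rw [hre2]
    have e : (s * ((L + 1 : ℕ) : ℝ) ^ 2) ^ 2 = s ^ 2 * (((L + 1 : ℕ) : ℝ) ^ 2) ^ 2 := by ring
    rw [e]
    have h4 : ((L + 1 : ℕ) : ℝ) ^ 4 = (((L + 1 : ℕ) : ℝ) ^ 2) ^ 2 := by ring
    rw [h4] at hlro
    have hsq : 0 ≤ ((L + 1 : ℕ) : ℝ) ^ 2 := by positivity
    nlinarith [mul_le_mul_of_nonneg_right hCL hsq]
  -- (iii) `√c ≤ m*` by density
  refine le_of_forall_lt_imp_le_of_dense fun a ha => ?_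
  by_cases ha0 : a ≤ 0
  · exact ha0.trans (dWaveOrderParameterTT'_nonneg t' U μ)
  push Not at ha0
  have ha2 : a ^ 2 < c := by
    have hsc := Real.sq_sqrt hc.le
    nlinarith [Real.sqrt_nonneg c, ha, ha0]
  have h := hstep (Real.sqrt 2 * a) (by positivity)
    (by rw [mul_pow, Real.sq_sqrt (by norm_num : (0 : ℝ) ≤ 2)]; linarith)
  have e : Real.sqrt 2 * (Real.sqrt 2 * a) / 2 = a := by
    rw [← mul_assoc, Real.mul_self_sqrt (by norm_num : (0 : ℝ) ≤ 2)]; ring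
  rwa [e] at h


end PairFieldLROTT

end Literature.MathematicalPhysics.QuantumLattice

end
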